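/-
Origin: expansion seat `planner-pub-hodgecm-mc-period-1-g9-0`, handover #1098 2026-08-19T18:33Z md5 2e385af43688854308622ec554c99efd (NEW additive leaf; LAYER B of (S-restr): S-side line representations lineRep/lineRepOf k + op/prod/seesaw junction theorems; installs after K-1 #K309/#K310, unitary-1 WmInstanceV2, #1097; bounce drops #1098+#1099) (`HOME/mc/pub-hodgecm-mc-period-1-g9/stage/HodgeCM/Model/ArchSideTerm.lean`, md5 2e385af4, 227 lines);
landed by the gen-13 packager (p-g13) in gate run 37 as `HodgeCM/Model/ArchSideTerm.lean` (stripped 6 trailing import-line comments).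
-/
/-
HodgeCM/Model/ArchSideTerm.lean — period-1 lane, LAYER B of (S-restr): the S-SIDE LINE REPRESENTATIONS of the period packet at the
W pin, with the operator-level see-saw `op`/`prod` (lines 0,1; binder-1 `SeesawCore.ofOp`) and the Θ-value see-saw `seesaw` (lines 2,3;
binder-1 `SeesawHyp34.seesaw`) as THEOREMS.

STATUS (r4, 2026-08-19T18:25Z, period-1-g9): COMPILED in the M-deny RUN-36 world (PKG RUN-35 oleans + the 26 RUN-36 cone modules of
this file built privately with the RUN-36 row-#0 name entries; this file's own bytes carry no such line — the entries are inherited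
from the K-1 twins it imports): rc 0, 0 errors, 0 warnings, no placeholders, 48 s; the foundational-dependency census of all 12 declarations is {propext,
Classical.choice, Quot.sound}.  Its first two imports are the K-1 group (v) twins (#K309/#K310) of the tree files
`Literature/NumberTheory/GelbartRogawski1991/UnitaryDualPairSeesawCMLines.lean` (p190686 + p190873, d19808c62baa) and
`…/UnitaryDualPairSeesawCMLinesConj.lean` (p191266, 15307a34bf47).  Every proof below is a ONE-LINE instantiation of a tree theorem;
the junction hazards (J1)–(J5) of §J were confirmed at compile time ((J2) by explicit qualification: `lineRep` is typed over the tree's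
`Literature.NumberTheory.Automorphic.relNormOneIdeles`, `lineRepOf` over the PKG `NumberField.relNormOneIdeles`, `g` is coerced to
`HodgeCM.Adelic.adelicUnitaryGroup`; the two copies are definitionally equal and the elaborator bridges them).  No records, no cited
facts, no E-binder: the only hypotheses are the W pin's own section variables `hGR η` (unitary-1 `WmInstanceV2` §V2), the four
small-pair splittings `hGR₀ hGR₁ hGR₂ hGR₃` [GR91 Prop. 3.1.1 verbatim, = `CompatibleSplitting` of `cmSplittingDatum … (lineVec (b k))`],
the η-split `η₀ η₁ η₂ η₃` (model1 (A3)(b): parametric; the S-term CHOOSES them — D5-MEMO §3 (N-S)) and, as THEOREM binders, the two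
splitting identities `hη01` / `hη23`.  The S pin TERM `archSideOf : ThetaAdelicSide V c` (§S) is NOT in this file: it is the RUN-37
additive leaf built on top of this one from the framed majorants / `theta_rat` theorems (tree `…SeesawCMLinesFramed.lean`, discharge-4)
or theta-3's `restrictTwist`.

Origin: Hodge-CM model-construction cell, row `S` of BINDER-OWNERS (period-1), (S-restr)/(x-S) of BINDER-TRIAGE; mathematics =
[Howe1979 §3; Kudla1984 §1; GelbartRogawski1991 §3.1 p. 455/457; Weil1964 III n°41] as reproduced in the two tree files.
-/
import Literature.NumberTheory.GelbartRogawski1991.UnitaryDualPairSeesawCMLines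
import Literature.NumberTheory.GelbartRogawski1991.UnitaryDualPairSeesawCMLinesConj
import Summits.HodgeConjecture.HodgeCM.Model.WmInstanceV2
import Summits.HodgeConjecture.HodgeCM.Model.ThetaSpaceInputPin_2
import Summits.HodgeConjecture.HodgeCM.Model.ArchSideInstance
import Summits.HodgeConjecture.HodgeCM.Automorphic.AdelicTorusThetaData_2

-- G11b-3 recipe (port D30 slow-export class; ops-buildfix LEDGER B13-1/B13-3): elaborate sequentially so the trailing
-- `attribute [implicit_reducible]` block (reducibilityCoreExt is keyed to the async environment branch) is in force at `.olean` export.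
set_option Elab.async false

set_option autoImplicit false

noncomputable section

open scoped Matrix
open NumberField
open Literature.NumberTheory.Automorphic Literature.NumberTheory.Weil1964
open Literature.NumberTheory.GelbartRogawski1991.UnitaryDualPair
open HodgeCM.Adelic HodgeCM.PerL34

namespace HodgeCM.Model

namespace ArchSideTerm

variable {L : CMField} {ι₁ : L →+* ℂ} (V : HermSpace3 L ι₁) (S : StubTree.SeesawDatum L)

/-! ## §J Junction hazards (all confirmed at compile time, r4)
(J1) `Matrix.diagonal (dW S) = S.gramW` — `WmInstanceV2.diagonal_dW` (rfl) + `gramW` abbrev.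
(J2) `relNormOneIdeles L⁺ L` of `SeesawTorus` (PKG `HodgeCM.PerL34`/`NumberField` copy) vs the tree's
     `Literature.NumberTheory.Automorphic.relNormOneIdeles` in `cmPlaneTorusIdeles` — both `(AdeleRing.ideleGalNorm L⁺ L).ker`; binder-1's
     `op` elaborates across them (defeq) and so do `lineRepOf` / the three junction theorems below, once each occurrence is
     namespace-qualified (an unqualified `relNormOneIdeles` / `adelicUnitaryGroup` is an «Ambiguous term» here).
(J3) `conjRingHomK L = (IsCMField.complexConj L : L →+* L)` (rfl, used by the pin's `frameD_real`) — turns `S.isoGL_spec` into `hg₀`.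
(J4) `(W V c).ρ = (cmPairRepTwist …).toHomUnits` (`wmInputCM₂_ρ`, rfl) and `((f.toHomUnits x : (X →ₗ[ℂ] X)ˣ) : X →ₗ[ℂ] X) = f x` (rfl).
(J5) `((S V c).P k).ω` must be `lineRepOf k` ON THE NOSE for binder-1's `op`/`seesaw` to be these theorems: theta-3 g9's `restrictTwist`
     takes `lineRepOf k` as input and only PROVES majorants / theta_rat about it (agreed (A2)); `e₁ := Equiv.prodUnique (Fin 3) (Fin 1)` so
     that `n₁ = 3` syntactically (binder-1: `φ₁ φ₂ : piSchwartzBruhat L⁺ (Fin 3)`, `τ : 𝒮(Fin 3) →ₗ 𝒮(Fin 3) →ₗ 𝒮(Fin 6)`, (A1)). -/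

/-- the line index equivalence `Fin 3 × Fin 1 ≃ Fin 3` (so that the line currency is `𝒮(𝔸^{Fin 3})` on the nose, (J5)). -/
abbrev e₁ : Fin 3 × Fin 1 ≃ Fin 3 := Equiv.prodUnique (Fin 3) (Fin 1)

/-- the second plane's Gram vector `(a₂, a₃)`. -/
def dW' : Fin 2 → L := ![S.a 2, S.a 3]

/-- (Ported verbatim from the HodgeCMPerL package; no docstring in the source.) -/
theorem dW'_real : ∀ i, IsCMField.complexConj L (dW' S i) = dW' S i := by
  intro i; fin_cases i <;> exact S.a_real _

/-- (Ported verbatim from the HodgeCMPerL package; no docstring in the source.) -/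
theorem dW'_ne : ∀ i, dW' S i ≠ 0 := by
  intro i; fin_cases i <;> exact S.a_ne _

/-- (J3) the pin's rational isometry `isoGL : diag(a₂,a₃) ≅ diag(a₀,a₁)` in the tree shape `hg₀`. -/
theorem isoGL_hg₀ :
    (((S.isoGL : GL (Fin 2) L) : Matrix (Fin 2) (Fin 2) L).map (IsCMField.complexConj L : (L : Type) →+* L))ᵀ *
        Matrix.diagonal (dW S) * ((S.isoGL : GL (Fin 2) L) : Matrix (Fin 2) (Fin 2) L) = Matrix.diagonal (dW' S) :=
  S.isoGL_spec      -- (J1) + (J3): `gramW = diagonal (dW S)`, `gramW' = diagonal (dW' S)`, `conjRingHomK = complexConj` all rfl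

section Lines

variable
  (hGR : (cmSplittingDatum (L : Type) finProdFinEquiv (frameD V) (frameD_real V) (frameD_ne V) (dW S) (dW_real S) (dW_ne S)).CompatibleSplitting)
  /- [GR91 Prop. 3.1.1, p. 455] for the four small pairs `(U(V), U(⟨a_k⟩))` — the SAME published theorem as `hGR`, at rank `3 × 1`: -/
  (hGR₀ : (cmSplittingDatum (L : Type) (e₁) (frameD V) (frameD_real V) (frameD_ne V) (lineVec (L : Type) (dW S 0))
    (fun _ => dW_real S 0) (fun _ => dW_ne S 0)).CompatibleSplitting)
  (hGR₁ : (cmSplittingDatum (L : Type) (e₁) (frameD V) (frameD_real V) (frameD_ne V) (lineVec (L : Type) (dW S 1))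
    (fun _ => dW_real S 1) (fun _ => dW_ne S 1)).CompatibleSplitting)
  (hGR₂ : (cmSplittingDatum (L : Type) (e₁) (frameD V) (frameD_real V) (frameD_ne V) (lineVec (L : Type) (dW' S 0))
    (fun _ => dW'_real S 0) (fun _ => dW'_ne S 0)).CompatibleSplitting)
  (hGR₃ : (cmSplittingDatum (L : Type) (e₁) (frameD V) (frameD_real V) (frameD_ne V) (lineVec (L : Type) (dW' S 1))
    (fun _ => dW'_real S 1) (fun _ => dW'_ne S 1)).CompatibleSplitting)
  (η : CMAdelic (L : Type) (frameD V) × CMAdelic (L : Type) (dW S) →* ℂˣ)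
  /- the η-split of record (model1 (A3)(b); chosen by the S-term, e.g. `cmEta₀ η`, `cmEta₁ η ∘ snd`, or the (N-S)-normalised one): -/
  (η₀ η₁ η₂ η₃ : CMAdelic (L : Type) (frameD V) × CMAdelicOne (L : Type) →* ℂˣ)
/- the η-splitting hypotheses are THEOREM binders (used in proofs only):
  `hη01 : ∀ v u₀ u₁, η (v, cmPlaneTorus (L : Type) (dW S) (u₀, u₁)) = η₀ (v, u₀) * η₁ (v, u₁)` (lines 0,1),
  `hη23 : ∀ v u₀ u₁, η (v, cmConjPlaneTorus (L : Type) (dW S) (dW' S) S.isoGL (isoGL_hg₀ S) (u₀, u₁)) = η₂ (v, u₀) * η₃ (v, u₁)` (lines 2,3). -/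

/-- **the S-side line representation of line `k`** on `CMAdelic (frameD V) × ker N_{L/L⁺}` in the currency `𝒮(𝔸^{Fin 3})`:
lines `0,1` = `cmLineRepFin₀/₁` of the plane `diag(a₀,a₁)`, lines `2,3` = `cmConjLineRepFin₀/₁` of the conjugated plane `isoGL·diag(a₂,a₃)·isoGL⁻¹`.
(`![…]` so that `lineRep … 2` reduces by `rfl`.) -/
def lineRep : Fin 4 →
    Representation ℂ (CMAdelic (L : Type) (frameD V) ×
        ↥(Literature.NumberTheory.Automorphic.relNormOneIdeles (↥(maximalRealSubfield L)) L))
      (piSchwartzBruhat (↥(maximalRealSubfield L)) (Fin 3)) :=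
  ![cmLineRepFin₀ (L : Type) finProdFinEquiv e₁ (frameD V) (frameD_real V) (frameD_ne V) (dW S) (dW_real S) (dW_ne S) hGR hGR₀ hGR₁ η₀,
    cmLineRepFin₁ (L : Type) finProdFinEquiv e₁ (frameD V) (frameD_real V) (frameD_ne V) (dW S) (dW_real S) (dW_ne S) hGR hGR₀ hGR₁ η₁,
    cmConjLineRepFin₀ (L : Type) finProdFinEquiv e₁ (frameD V) (frameD_real V) (frameD_ne V) (dW S) (dW_real S) (dW_ne S)
      (dW' S) (dW'_real S) (dW'_ne S) S.isoGL (isoGL_hg₀ S) hGR hGR₂ hGR₃ η₂,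
    cmConjLineRepFin₁ (L : Type) finProdFinEquiv e₁ (frameD V) (frameD_real V) (frameD_ne V) (dW S) (dW_real S) (dW_ne S)
      (dW' S) (dW'_real S) (dW'_ne S) S.isoGL (isoGL_hg₀ S) hGR hGR₂ hGR₃ η₃]

/-- `lineRep k` pulled back to the S pin's group `(V.latticeModel hP).G × U(1)(𝔸) = ↥(regimeSubgroup L V.Hm) × ker N` (`latticeModel_G` rfl)
along `regimeSubgroup ↪ U(V.Hm)(𝔸) ≅ CMAdelic (frameD V)` (the W pin's `eV = cmFrameEquiv`): this is the `ω` handed to theta-3's `restrictTwist` (J5).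
(J2): the second factor is the TREE `Literature.NumberTheory.Automorphic.relNormOneIdeles`; `WeilPairData.ω` is typed with the PKG
`NumberField.relNormOneIdeles` — same `(ideleGalNorm L⁺ L).ker`, binder-1's `op` already elaborates across the two. -/
def lineRepOf (k : Fin 4) :
    Representation ℂ (↥(regimeSubgroup L V.Hm) × ↥(NumberField.relNormOneIdeles (↥(maximalRealSubfield L)) L))
      (piSchwartzBruhat (↥(maximalRealSubfield L)) (Fin 3)) :=
  (lineRep V S hGR hGR₀ hGR₁ hGR₂ hGR₃ η₀ η₁ η₂ η₃ k).comp
    (((cmFrameEquiv (L : Type) (frameG V) V.Hm (frameD V) (frame_congr V)).toMonoidHom.comp (regimeSubgroup L V.Hm).subtype).prodMap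
      (MonoidHom.id _))

/-- binder-1's bilinear `τ` for lines `0,1`: `⊗″` in the currencies `𝒮(Fin 3) ⊗ 𝒮(Fin 3) → 𝒮(Fin 6)`. -/
def tau12 : piSchwartzBruhat (↥(maximalRealSubfield L)) (Fin 3) →ₗ[ℂ] piSchwartzBruhat (↥(maximalRealSubfield L)) (Fin 3) →ₗ[ℂ]
    piSchwartzBruhat (↥(maximalRealSubfield L)) (Fin 6) :=
  cmLineTensorFin (L : Type) finProdFinEquiv e₁ (frameD V) (frameD_real V) (frameD_ne V) (dW S) (dW_real S) (dW_ne S)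

/-- binder-1's bilinear `τ` for lines `2,3` (`SeesawHyp34.τ`). -/
def tau34 : piSchwartzBruhat (↥(maximalRealSubfield L)) (Fin 3) →ₗ[ℂ] piSchwartzBruhat (↥(maximalRealSubfield L)) (Fin 3) →ₗ[ℂ]
    piSchwartzBruhat (↥(maximalRealSubfield L)) (Fin 6) :=
  cmConjLineTensorFin (L : Type) finProdFinEquiv e₁ (frameD V) (frameD_real V) (frameD_ne V) (dW S) (dW_real S) (dW_ne S)
    (dW' S) (dW'_real S) (dW'_ne S) S.isoGL (isoGL_hg₀ S)

/-- **`prod`** of `SeesawCore.ofOp`: `Θ₆(τ φ₁ φ₂) = Θ₃(φ₁) · Θ₃(φ₂)`. -/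
theorem prod_tau12 (φ₁ φ₂ : piSchwartzBruhat (↥(maximalRealSubfield L)) (Fin 3)) :
    thetaDistLM (↥(maximalRealSubfield L)) (Fin 6) (tau12 V S φ₁ φ₂) =
      thetaDistLM (↥(maximalRealSubfield L)) (Fin 3) φ₁ * thetaDistLM (↥(maximalRealSubfield L)) (Fin 3) φ₂ :=
  thetaDistLM_cmLineTensorFin (L : Type) finProdFinEquiv e₁ (frameD V) (frameD_real V) (frameD_ne V) (dW S) (dW_real S) (dW_ne S) φ₁ φ₂

/-- (Ported verbatim from the HodgeCMPerL package; no docstring in the source.) -/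
theorem prod_tau34 (φ₁ φ₂ : piSchwartzBruhat (↥(maximalRealSubfield L)) (Fin 3)) :
    thetaDistLM (↥(maximalRealSubfield L)) (Fin 6) (tau34 V S φ₁ φ₂) =
      thetaDistLM (↥(maximalRealSubfield L)) (Fin 3) φ₁ * thetaDistLM (↥(maximalRealSubfield L)) (Fin 3) φ₂ :=
  thetaDistLM_cmConjLineTensorFin (L : Type) finProdFinEquiv e₁ (frameD V) (frameD_real V) (frameD_ne V) (dW S) (dW_real S) (dW_ne S)
    (dW' S) (dW'_real S) (dW'_ne S) S.isoGL (isoGL_hg₀ S) φ₁ φ₂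

/-- **`op`** of `SeesawCore.ofOp` at the level of `cmPairRepTwist` (the W pin's `ρ` by `wmInputCM₂_ρ`, (J4)): for `g ∈ U(V.Hm)(𝔸)`,
`t ∈ T(𝔸)`, `(ω_ψ ∘ (s_pair ⊗ η))(eV g, eW (jT₁₂ t)) (τ φ₁ φ₂) = τ (lineRepOf 0 (g, t₀) φ₁) (lineRepOf 1 (g, t₁) φ₂)`. -/
theorem op_lineRepOf (g : ↥(regimeSubgroup L V.Hm)) (t : SeesawTorus (↥(maximalRealSubfield L)) L)
    (hη01 : ∀ (v : CMAdelic (L : Type) (frameD V)) (u₀ u₁ : CMAdelicOne (L : Type)),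
      η (v, cmPlaneTorus (L : Type) (dW S) (u₀, u₁)) = η₀ (v, u₀) * η₁ (v, u₁))
    (φ₁ φ₂ : piSchwartzBruhat (↥(maximalRealSubfield L)) (Fin 3)) :
    cmPairRepTwist (L : Type) finProdFinEquiv (frameD V) (frameD_real V) (frameD_ne V) (dW S) (dW_real S) (dW_ne S) hGR η
        ((cmFrameEquiv (L : Type) (frameG V) V.Hm (frameD V) (frame_congr V)) (g : ↥(HodgeCM.Adelic.adelicUnitaryGroup (L : Type) V.Hm)),
          cmAdelicEquiv (L : Type) 2 (Matrix.diagonal (dW S)) (S.jT₁₂ t)) (tau12 V S φ₁ φ₂) =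
      tau12 V S (lineRepOf V S hGR hGR₀ hGR₁ hGR₂ hGR₃ η₀ η₁ η₂ η₃ 0 (g, SeesawTorus.fst _ L t) φ₁)
        (lineRepOf V S hGR hGR₀ hGR₁ hGR₂ hGR₃ η₀ η₁ η₂ η₃ 1 (g, SeesawTorus.snd _ L t) φ₂) :=
  cmPairRepTwist_cmAdelicEquiv_cmLineTensorFin (L : Type) finProdFinEquiv e₁ (frameD V) (frameD_real V) (frameD_ne V) (dW S) (dW_real S)
    (dW_ne S) hGR hGR₀ hGR₁ η η₀ η₁ hη01 _ (S.jT₁₂ t) (SeesawTorus.fst _ L t) (SeesawTorus.snd _ L t)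
    (TorusEmbedding.val_toGL (L : Type) t)  -- (J2): `coe_jT` rfl + `val_toGL`
    φ₁ φ₂

/-- **`seesaw`** of `SeesawHyp34` (lines 2,3, Θ-value level): for `x = eW (jT₃₄ t) = isoGL · diag(t₀,t₁) · isoGL⁻¹`. -/
theorem seesaw34_lineRepOf (g : ↥(regimeSubgroup L V.Hm)) (t : SeesawTorus (↥(maximalRealSubfield L)) L)
    (hη23 : ∀ (v : CMAdelic (L : Type) (frameD V)) (u₀ u₁ : CMAdelicOne (L : Type)),
      η (v, cmConjPlaneTorus (L : Type) (dW S) (dW' S) S.isoGL (isoGL_hg₀ S) (u₀, u₁)) = η₂ (v, u₀) * η₃ (v, u₁))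
    (φ₂ φ₃ : piSchwartzBruhat (↥(maximalRealSubfield L)) (Fin 3)) :
    thetaDistLM (↥(maximalRealSubfield L)) (Fin 6)
        (cmPairRepTwist (L : Type) finProdFinEquiv (frameD V) (frameD_real V) (frameD_ne V) (dW S) (dW_real S) (dW_ne S) hGR η
          ((cmFrameEquiv (L : Type) (frameG V) V.Hm (frameD V) (frame_congr V)) (g : ↥(HodgeCM.Adelic.adelicUnitaryGroup (L : Type) V.Hm)),
            cmAdelicEquiv (L : Type) 2 (Matrix.diagonal (dW S)) (S.jT₃₄ t)) (tau34 V S φ₂ φ₃)) =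
      thetaDistLM (↥(maximalRealSubfield L)) (Fin 3)
          (lineRepOf V S hGR hGR₀ hGR₁ hGR₂ hGR₃ η₀ η₁ η₂ η₃ 2 (g, SeesawTorus.fst _ L t) φ₂) *
        thetaDistLM (↥(maximalRealSubfield L)) (Fin 3)
          (lineRepOf V S hGR hGR₀ hGR₁ hGR₂ hGR₃ η₀ η₁ η₂ η₃ 3 (g, SeesawTorus.snd _ L t) φ₃) :=
  thetaDistLM_cmPairRepTwist_cmAdelicEquiv_cmConjLineTensorFin (L : Type) finProdFinEquiv e₁ (frameD V) (frameD_real V) (frameD_ne V)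
    (dW S) (dW_real S) (dW_ne S) (dW' S) (dW'_real S) (dW'_ne S) S.isoGL (isoGL_hg₀ S) hGR hGR₂ hGR₃ η η₂ η₃ hη23 _ (S.jT₃₄ t)
    (TorusEmbedding.toGL (L : Type) t) (SeesawTorus.fst _ L t) (SeesawTorus.snd _ L t) (TorusEmbedding.val_toGL (L : Type) t)
    (S.coe_jT₃₄_apply t)  -- `hx`: PKG `coe_jT₃₄_apply` is literally `toAdeleGL isoGL * toGL t * (toAdeleGL isoGL)⁻¹`
    φ₂ φ₃

/-- the operator-level version for lines `2,3` as well (if binder-1 prefers `ofOp` there too). -/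
theorem op34_lineRepOf (g : ↥(regimeSubgroup L V.Hm)) (t : SeesawTorus (↥(maximalRealSubfield L)) L)
    (hη23 : ∀ (v : CMAdelic (L : Type) (frameD V)) (u₀ u₁ : CMAdelicOne (L : Type)),
      η (v, cmConjPlaneTorus (L : Type) (dW S) (dW' S) S.isoGL (isoGL_hg₀ S) (u₀, u₁)) = η₂ (v, u₀) * η₃ (v, u₁))
    (φ₂ φ₃ : piSchwartzBruhat (↥(maximalRealSubfield L)) (Fin 3)) :
    cmPairRepTwist (L : Type) finProdFinEquiv (frameD V) (frameD_real V) (frameD_ne V) (dW S) (dW_real S) (dW_ne S) hGR η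
        ((cmFrameEquiv (L : Type) (frameG V) V.Hm (frameD V) (frame_congr V)) (g : ↥(HodgeCM.Adelic.adelicUnitaryGroup (L : Type) V.Hm)),
          cmAdelicEquiv (L : Type) 2 (Matrix.diagonal (dW S)) (S.jT₃₄ t)) (tau34 V S φ₂ φ₃) =
      tau34 V S (lineRepOf V S hGR hGR₀ hGR₁ hGR₂ hGR₃ η₀ η₁ η₂ η₃ 2 (g, SeesawTorus.fst _ L t) φ₂)
        (lineRepOf V S hGR hGR₀ hGR₁ hGR₂ hGR₃ η₀ η₁ η₂ η₃ 3 (g, SeesawTorus.snd _ L t) φ₃) :=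
  cmPairRepTwist_cmAdelicEquiv_cmConjLineTensorFin (L : Type) finProdFinEquiv e₁ (frameD V) (frameD_real V) (frameD_ne V)
    (dW S) (dW_real S) (dW_ne S) (dW' S) (dW'_real S) (dW'_ne S) S.isoGL (isoGL_hg₀ S) hGR hGR₂ hGR₃ η η₂ η₃ hη23 _ (S.jT₃₄ t)
    (TorusEmbedding.toGL (L : Type) t) (SeesawTorus.fst _ L t) (SeesawTorus.snd _ L t) (TorusEmbedding.val_toGL (L : Type) t)
    (S.coe_jT₃₄_apply t) φ₂ φ₃

/- rational points (`theta_rat` of `WeilPairData`): tree `cmLineRepRaw₀/₁_toHomUnits_mem_thetaStabilizer` (LAYER A §5) and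
   `cmConjLineRepRaw₀/₁_toHomUnits_mem_thetaStabilizer` (LAYER A″ §5) give it for the RAW line reps on `CMRat dV × CMRat (lineVec (b k))`;
   the η_k-twisted / `Fin`-currency / `eV`-pulled-back form is theta-3 g9's `restrictTwist` business ((A2); rational points of `eV` =
   `cmFrameEquiv_mem_range_toAdelic`, of `U(1)` = `cmAdelicOneEquivRelNormOne_mem_relNormOneRat_iff`). -/

end Lines

/-! ## §S The S pin term (skeleton of the RUN-37 additive leaf; `restrictTwist` = theta-3, or the framed tree theorems of discharge-4)

```
def archSideOf (c : SeesawCtx L) … : ThetaAdelicSide V c where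
  P k      := restrictTwist (lineRepOf V c.D hGR hGR₀ hGR₁ hGR₂ hGR₃ η₀ η₁ η₂ η₃ k) …   -- ω := lineRepOf k ON THE NOSE (J5);
                                                                                        -- majorants / theta_rat / Φinf / x₀ / w / weight: theta-3
  hΓU      := …                          -- `(P k).ΓU = (V.latticeModel hP).Γ = regimeRat L V.Hm` (`latticeModel_Γ` rfl): theta-3's `restrictTwist` sets ΓU; if it
                                         -- takes ΓU as an argument pass `(V.latticeModel printFact_unitaryCompact_holds).Γ` and `hΓU k := rfl`
  ιinf     := Model.archInfOf V          -- #1097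
  Gfin     := Model.archFinOf V          -- #1097
  comm_fin := Model.commute_archFinOf_archInfOf V
  rat_split := Model.rat_split_archInfOf V

-- `P_eq_restrict` of theta-3 HANDOFF §9 = (J5) read back:
theorem archSideOf_P_ω (k : Fin 4) : ((archSideOf V c …).P k).ω = lineRepOf V c.D hGR hGR₀ hGR₁ hGR₂ hGR₃ η₀ η₁ η₂ η₃ k := rfl
theorem archSideOf_ιinf : (archSideOf V c …).ιinf = Model.archInfOf V := rfl
```
Exports for binder-1: `op_lineRepOf` + `prod_tau12` ⇒ `SeesawCore.ofOp (τ := tau12 V c.D)` (after `wmInputCM₂_ρ`, (J4); `g : ↥(regimeSubgroup L V.Hm)` exactly as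
binder-1's `op` — since r2 the regime restriction `(regimeSubgroup L V.Hm).subtype` lives INSIDE `lineRepOf`); `seesaw34_lineRepOf` ⇒ `SeesawHyp34.seesaw (τ := tau34 V c.D)`. -/


end ArchSideTerm

end HodgeCM.Model

end
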